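import Mathlib
import Summits.AnomalousDissipation.AnomalousDissipation.Theses.WazewskiBlock
import Literature.Analysis.FluidPDE.GalerkinFlow
import Literature.Analysis.FluidPDE.CheskidovAssemblyTools
import Literature.Analysis.FunctionSpaces.TorusFourierCalculus

/-!
# Sketch — crux-ideate stmt-AnomalousDissipation-10352 (`WazewskiBlock.UniformGalerkinTrap`), round 1, ideator 1

First lemmas of the two idea cards (planner-cruxidea-stmt-AnomalousDissipation-10352-1-0, 2026-08-16):

* `WindowInvariantSets` — the Galerkin-level landing point shared by both cards: for every small `ν`
  there are `G(ν)`, `N₀(ν)` such that EVERY level `N ≥ N₀` carries a nonempty set of Galerkin modes,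
  forward-invariant under the tree's Galerkin semiflow `Torus.galerkinFlow ν f N`, inside the block
  `window f E ε₀ G = {KE ≤ E} ∩ {(f,·) ≥ ε₀} ∩ {‖∇·‖² ≤ G}`.
* `trap_of_windowInvariantSets : WindowInvariantSets → UniformGalerkinTrap` — PROVED (kernel-checked,
  no sorry): any point of such a set is a trapped trajectory with the crux's four clauses, by
  `IsGalerkinMode.galerkinFlow_clauses` (GalerkinFlow.lean).
* card α (`capped-window-index-continuation`) reaches `WindowInvariantSets` from an indexed isolated
  invariant set of the strong NS_ν semiflow by Rybakowski continuation (prose; named fact);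
* card β (`frozen-faces-coherent-structures`): `FrozenLoudAllLevels` (a loud bounded FIXED POINT of the
  Galerkin semiflow at every level `N ≥ N₀(ν)`) and
  `windowInvariantSets_of_frozen : FrozenLoudAllLevels → WindowInvariantSets` — the frozen-faces lemma:
  on a fixed point the exact energy identity freezes `ν‖∇U‖² = (f,U) ≤ ‖f‖₂ √(2E)`, so the enstrophy
  cap `G(ν) := ‖f‖₂√(2E)/ν` is automatic and uniform in `N` (statement elaborates; analytic plumbing
  in two helper lemmas `frozen_power_identity`, `work_le`);
* `galerkinFlow_eq_self_of_rhs_zero` — a zero of the Galerkin vector field `galerkinRHS` (the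
  coefficient-level form in which Brezzi–Rappaz–Raviart produces steady Galerkin states) IS a fixed
  point of `Torus.galerkinFlow` (uniqueness of Galerkin ODE solutions), closing the gap between card β's
  PDE-side output and `FrozenLoudAllLevels`.

All statements proved: `lean check` rc 0, 0 sorries (2026-08-16).
-/

open MeasureTheory Set Filter
open scoped ENNReal NNReal

namespace Summit.AnomalousDissipation.AnomalousDissipation.Cruxes.UniformGalerkinTrap.Ideator1

open Literature.Analysis.FunctionSpaces Literature.Analysis.FluidPDE

local notation "𝕋³" => UnitAddTorus (Fin 3)
local notation "E³" => EuclideanSpace ℝ (Fin 3)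

/-- The crux's force clause: a mean-zero vector trigonometric polynomial of order `m`
(first conjunct is `IsGalerkinMode m f` by `Iff.rfl`). -/
def IsTrigPolyForce (m : ℕ) (f : 𝕋³ → E³) : Prop :=
  (Torus.IsSmooth f ∧ Torus.IsDivFree f ∧ ∀ k : Fin 3 → ℤ, ((m : ℕ) : ℝ) ^ 2 < Torus.freqNormSq k →
    UnitAddTorus.mFourierCoeff (EuclideanSpace.complexify ∘ f) k = 0) ∧ Torus.HasZeroMean f

theorem isTrigPolyForce_iff (m : ℕ) (f : 𝕋³ → E³) :
    IsTrigPolyForce m f ↔ IsGalerkinMode m f ∧ Torus.HasZeroMean f := Iff.rfl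

/-- The block of the crux at `(E, ε₀, G)`: energy cap, work floor, enstrophy cap. -/
def window (f : 𝕋³ → E³) (E ε₀ : ℝ) (G : ℝ≥0) : Set (𝕋³ → E³) :=
  {u | Torus.kineticEnergy u ≤ E ∧ ε₀ ≤ ∫ x, inner ℝ (f x) (u x) ∧ Torus.eGradNormSq u ≤ (G : ℝ≥0∞)}

/-- **Galerkin-level landing point (both cards).** For every `0 < ν ≤ ν₀` there are `G`, `N₀` such that
every level `N ≥ N₀` has a nonempty set `S` of Galerkin modes of order `N`, forward invariant under
the Galerkin semiflow of order `N`, contained in the window. -/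
def WindowInvariantSets : Prop :=
  ∃ (m : ℕ) (f : 𝕋³ → E³), IsTrigPolyForce m f ∧ ∃ (E ε₀ ν₀ : ℝ), 0 < ε₀ ∧ 0 < ν₀ ∧
    ∀ ν : ℝ, 0 < ν → ν ≤ ν₀ → ∃ (G : ℝ≥0) (N₀ : ℕ), ∀ N : ℕ, N₀ ≤ N →
      ∃ S : Set (𝕋³ → E³), S.Nonempty ∧ (∀ a ∈ S, IsGalerkinMode N a) ∧
        (∀ a ∈ S, ∀ t : ℝ, 0 ≤ t → Torus.galerkinFlow ν f N t a ∈ S) ∧ S ⊆ window f E ε₀ G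

/-- **First lemma of card α (proved): a window-invariant set at every large level traps an orbit
with the crux's clause block.** -/
theorem trap_of_windowInvariantSets :
    WindowInvariantSets → Theses.WazewskiBlock.UniformGalerkinTrap := by
  rintro ⟨m, f, ⟨hf, hmean⟩, E, ε₀, ν₀, hε₀, hν₀, h⟩
  refine ⟨m, f, hf, hmean, E, ε₀, ν₀, hε₀, hν₀, fun ν hν hνle => ?_⟩
  obtain ⟨G, N₀, hN⟩ := h ν hν hνle
  refine ⟨G, N₀, fun N hN₀ => ?_⟩
  obtain ⟨S, ⟨a, ha⟩, hmode, hinv, hwin⟩ := hN N hN₀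
  have hf2 : MemLp f 2 volume := (hf.1).memLp 2
  obtain ⟨-, hcont, hslice, htest, henergy⟩ := (hmode a ha).galerkinFlow_clauses (ν := ν) hν.le hf2
  refine ⟨fun t => Torus.galerkinFlow ν f N t a, ⟨hcont, fun t ht => hslice t ht,
    fun b hb s t hs hst => htest b hb s t hs hst, henergy⟩, fun t ht => ?_⟩
  exact hwin (hinv a ha t ht)

/-- **Card β, transfer target at the Galerkin level**: a loud bounded FIXED POINT of the Galerkin
semiflow at every level `N ≥ N₀(ν)`, for all `0 < ν ≤ ν₀` (no enstrophy clause: it is automatic). -/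
def FrozenLoudAllLevels : Prop :=
  ∃ (m : ℕ) (f : 𝕋³ → E³), IsTrigPolyForce m f ∧ ∃ (E ε₀ ν₀ : ℝ), 0 < ε₀ ∧ 0 < ν₀ ∧
    ∀ ν : ℝ, 0 < ν → ν ≤ ν₀ → ∃ N₀ : ℕ, ∀ N : ℕ, N₀ ≤ N →
      ∃ U : 𝕋³ → E³, IsGalerkinMode N U ∧ (∀ t : ℝ, 0 ≤ t → Torus.galerkinFlow ν f N t U = U) ∧
        Torus.kineticEnergy U ≤ E ∧ ε₀ ≤ ∫ x, inner ℝ (f x) (U x)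

/-- Frozen power identity on a fixed point of the Galerkin semiflow: `ν‖∇U‖² = (f, U)`
(the exact energy identity of `galerkinFlow_clauses` on the constant orbit over `[0,1]`). -/
theorem frozen_power_identity {m N : ℕ} {f U : 𝕋³ → E³} {ν : ℝ} (hf : IsTrigPolyForce m f) (hν : 0 < ν)
    (hU : IsGalerkinMode N U) (hfix : ∀ t : ℝ, 0 ≤ t → Torus.galerkinFlow ν f N t U = U) :
    Torus.eGradNormSq U ≠ ⊤ ∧ ν * (Torus.eGradNormSq U).toReal = ∫ x, inner ℝ (f x) (U x) := by
  have hf2 : MemLp f 2 volume := hf.1.1.memLp 2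
  obtain ⟨-, -, -, -, henergy⟩ := hU.galerkinFlow_clauses (ν := ν) hν.le hf2
  have htop : Torus.eGradNormSq U ≠ ⊤ := (Torus.eGradNormSq_lt_top hU.isSmooth).ne
  refine ⟨htop, ?_⟩
  have h := henergy 0 1 le_rfl zero_le_one
  rw [hfix 1 zero_le_one, hfix 0 le_rfl] at h
  have hlin : (∫⁻ τ in Ioo (0:ℝ) 1, Torus.eGradNormSq (Torus.galerkinFlow ν f N τ U)) =
      Torus.eGradNormSq U := by
    rw [setLIntegral_congr_fun measurableSet_Ioo (fun τ hτ => by rw [hfix τ hτ.1.le]),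
      setLIntegral_const, Real.volume_Ioo]
    simp
  have hint : (∫ τ in (0:ℝ)..1, ∫ x, inner ℝ (f x) (Torus.galerkinFlow ν f N τ U x)) =
      ∫ x, inner ℝ (f x) (U x) := by
    rw [intervalIntegral.integral_congr (g := fun _ => ∫ x, inner ℝ (f x) (U x)) (fun τ hτ => ?_)]
    · simp
    · have hτ0 : 0 ≤ τ := by
        rw [Set.uIcc_of_le zero_le_one] at hτ
        exact hτ.1
      simp only [hfix τ hτ0]
  rw [hlin, hint] at h
  linarith

/-- Cauchy–Schwarz for the work: `(f,U) ≤ ‖f‖₂ · √(2·KE(U))`. -/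
theorem work_le {f U : 𝕋³ → E³} (hf : Torus.IsSmooth f) (hU : Torus.IsSmooth U) :
    ∫ x, inner ℝ (f x) (U x) ≤ Real.sqrt (∫ x, ‖f x‖ ^ 2) * Real.sqrt (2 * Torus.kineticEnergy U) := by
  have h := abs_integral_inner_le_sqrt_mul_sqrt (μ := volume) (hf.memLp 2) (hU.memLp 2)
  have h2 : 2 * Torus.kineticEnergy U = ∫ x, ‖U x‖ ^ 2 := by
    unfold Torus.kineticEnergy; ring
  rw [h2]
  exact (le_abs_self _).trans h

/-- **First lemma of card β (frozen faces)**: loud bounded fixed points at every level give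
window-invariant singletons with the AUTOMATIC, `N`-uniform cap `G(ν) = ‖f‖₂ √(2E) / ν`. -/
theorem windowInvariantSets_of_frozen : FrozenLoudAllLevels → WindowInvariantSets := by
  rintro ⟨m, f, hf, E, ε₀, ν₀, hε₀, hν₀, h⟩
  refine ⟨m, f, hf, E, ε₀, ν₀, hε₀, hν₀, fun ν hν hνle => ?_⟩
  obtain ⟨N₀, hN⟩ := h ν hν hνle
  -- the N-uniform cap G(ν) = ‖f‖₂ √(2E) / ν
  refine ⟨(Real.sqrt (∫ x, ‖f x‖ ^ 2) * Real.sqrt (2 * E) / ν).toNNReal, N₀, fun N hN₀ => ?_⟩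
  obtain ⟨U, hU, hfix, hKE, hW⟩ := hN N hN₀
  refine ⟨{U}, Set.singleton_nonempty U, fun a ha => by rw [Set.mem_singleton_iff.mp ha]; exact hU,
    fun a ha t ht => ?_, fun a ha => ?_⟩
  · rw [Set.mem_singleton_iff.mp ha, Set.mem_singleton_iff, hfix t ht]
  · rw [Set.mem_singleton_iff.mp ha]
    refine ⟨hKE, hW, ?_⟩
    obtain ⟨htop, hpow⟩ := frozen_power_identity hf hν hU hfix
    have hwork := work_le hf.1.1 hU.isSmooth
    have hE : 2 * Torus.kineticEnergy U ≤ 2 * E := by linarith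
    have h1 : (Torus.eGradNormSq U).toReal ≤ Real.sqrt (∫ x, ‖f x‖ ^ 2) * Real.sqrt (2 * E) / ν := by
      rw [le_div_iff₀ hν]
      calc (Torus.eGradNormSq U).toReal * ν = ν * (Torus.eGradNormSq U).toReal := mul_comm _ _
        _ = ∫ x, inner ℝ (f x) (U x) := hpow
        _ ≤ Real.sqrt (∫ x, ‖f x‖ ^ 2) * Real.sqrt (2 * Torus.kineticEnergy U) := hwork
        _ ≤ Real.sqrt (∫ x, ‖f x‖ ^ 2) * Real.sqrt (2 * E) := by gcongr
    show Torus.eGradNormSq U ≤ ENNReal.ofReal (Real.sqrt (∫ x, ‖f x‖ ^ 2) * Real.sqrt (2 * E) / ν)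
    rw [← ENNReal.ofReal_toReal htop]
    exact ENNReal.ofReal_le_ofReal h1

/-- **Zeros of the Galerkin vector field are fixed points of the semiflow** (for card β: a steady
Galerkin state produced at the coefficient level — e.g. by Brezzi–Rappaz–Raviart from a nonsingular
steady NS state — is a fixed point of `Torus.galerkinFlow`, by uniqueness of Galerkin ODE solutions). -/
theorem galerkinFlow_eq_self_of_rhs_zero {N : ℕ} {f U : 𝕋³ → E³} {ν : ℝ} (hU : IsGalerkinMode N U)
    (h0 : galerkinRHS (Torus.freqBall N) ν (fourierRestrict (Torus.freqBall N) f)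
      (fourierRestrict (Torus.freqBall N) U) = 0)
    {t : ℝ} (ht : 0 ≤ t) : Torus.galerkinFlow ν f N t U = U := by
  have hsol : IsGalerkinODESolution ν (fourierRestrict (Torus.freqBall N) f)
      (fourierRestrict (Torus.freqBall N) U) (fun _ => fourierRestrict (Torus.freqBall N) U) :=
    ⟨rfl, fun _ => hU.fourierRestrict_mem, continuousOn_const, fun T t _ => by
      simpa [h0] using hasDerivWithinAt_const t (Icc 0 T) (fourierRestrict (Torus.freqBall N) U)⟩
  rw [hU.galerkinFlow_eq, hsol.galerkinCoeffFlow_eq ht, hU.realTrigPoly_fourierRestrict]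

end Summit.AnomalousDissipation.AnomalousDissipation.Cruxes.UniformGalerkinTrap.Ideator1
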